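import Summits.MatrixMultiplication.MatrixMultiplication.Theorems.PairwiseCurvedTilingsLC.Negative.GenericInterior
import Literature.ModelTheory.PseudofiniteFields.DefinableProjection
import Summits.MatrixMultiplication.MatrixMultiplication.Theorems.PairwiseCurvedTilingsLC.Negative.FiniteChartFibre
import Literature.ModelTheory.PseudofiniteFields.DefinableSetsToolkit
import Literature.ModelTheory.PseudofiniteFields.EtaleImageCoordinateLine
import Mathlib.Algebra.MvPolynomial.Equiv

/-!
# The chart induction, Case 2, step A: the last coordinate is generically algebraic over the
# free coordinates (line LonelyTranslates c1, Prop27Reduction; part of the proof of `stub_openPiece`)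

Setting: a definable `A ⊆ K^{m+1}` (char-`0` pseudo-finite `K`) all of whose fibres over `K^m`
are FINITE, and a good chart of the projection `B ⊆ K^m`: a coordinate splitting
`σ' : Fin m ≃ Fin e ⊕ Fin k` (free `u`, bound `w`), a triangular system `D'_j(u, w) = 0`, and a
definable chart set `X' ⊆ B` lying on the nonsingular part of the chart.  Then there is a NON-ZERO
`P ∈ K[u][t]` with `P(u(x); x_last) = 0` for every `x ∈ A` over `X'`.

Proof: the `(t, u)`-projection `A_t ⊆ K^{e+1}` of `A ∩ {init ∈ X'}` is definable
(`stub_definable_projection`) and has finite `t`-fibres (finitely many `w` over each `u` on the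
chart, `stub_finite_chart_fibre`, and finitely many `t` over each point of `K^m`); a definable set
with finite fibres along a coordinate contains no nonempty basic étale-open set
(`EtaleDatum.line_trace_infinite_psf`), so by `stub_genericInterior` it lies in the zero set of
its exceptional polynomial `D_t ≠ 0`; `P` is `D_t` read in `K[u][t]` (`MvPolynomial.finSuccEquiv`).
-/

set_option linter.dupNamespace false

namespace Summit.MatrixMultiplication.MatrixMultiplication.Theorems.PairwiseCurvedTilingsLC.Negative

open FirstOrder FirstOrder.Language FirstOrder.Ring
open Literature.ModelTheory.PseudofiniteFields

section LiftRelation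

variable {K : Type} [Field K] {m e k : ℕ}

/-- The `(t, u)`-projection splitting: `Fin (m+1) ≃ Fin (e+1) ⊕ Fin k`, last coordinate to the
new free slot `0`, a free coordinate `u_i` to `i.succ`, a bound coordinate `w_j` to `j`. -/
theorem exists_projSplit (σ' : Fin m ≃ Fin e ⊕ Fin k) :
    ∃ τ : Fin (m + 1) ≃ Fin (e + 1) ⊕ Fin k,
      τ (Fin.last m) = Sum.inl 0 ∧
      (∀ i : Fin m, τ (Fin.castSucc i) = Sum.map Fin.succ id (σ' i)) ∧
      τ.symm (Sum.inl 0) = Fin.last m ∧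
      (∀ u : Fin e, τ.symm (Sum.inl u.succ) = Fin.castSucc (σ'.symm (Sum.inl u))) ∧
      (∀ j : Fin k, τ.symm (Sum.inr j) = Fin.castSucc (σ'.symm (Sum.inr j))) := by
  refine ⟨{ toFun := Fin.lastCases (Sum.inl 0) (fun i => Sum.map Fin.succ id (σ' i))
            invFun := Sum.elim (Fin.cases (Fin.last m) (fun u => Fin.castSucc (σ'.symm (Sum.inl u))))
              (fun j => Fin.castSucc (σ'.symm (Sum.inr j)))
            left_inv := fun i => ?_
            right_inv := fun s => ?_ }, ?_, fun i => ?_, rfl, fun u => rfl, fun j => rfl⟩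
  · cases i using Fin.lastCases with
    | last => simp
    | cast i =>
      simp only [Fin.lastCases_castSucc]
      rcases h : σ' i with u | j
      · simp only [Sum.map_inl, Sum.elim_inl, Fin.cases_succ]
        rw [← h, Equiv.symm_apply_apply]
      · simp only [Sum.map_inr, id_eq, Sum.elim_inr]
        rw [← h, Equiv.symm_apply_apply]
  · rcases s with u | j
    · cases u using Fin.cases with
      | zero => simp
      | succ u => simp
    · simp
  · simp [Equiv.coe_fn_mk]
  · simp

/-- **Case 2, step A: an algebraic relation for the last coordinate.** -/
theorem exists_poly_vanishing_on_last (h27 : ChatzidakisVanDenDriesMacintyre1992_prop27)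
    (K : Type) [Field K] [CompatibleRing K] [CharZero K] (hK : K ⊨ finiteFieldTheory)
    {m n e k : ℕ} (φ : Language.ring.Formula (Fin (m + 1) ⊕ Fin n)) (y : Fin n → K)
    (σ' : Fin m ≃ Fin e ⊕ Fin k) (D' : Fin k → MvPolynomial (Fin e ⊕ Fin k) K)
    (htri' : ∀ j i : Fin k, i < j → MvPolynomial.pderiv (Sum.inr i) (D' j) = 0)
    (X' : Set (Fin m → K))
    (hX'def : ∃ (n' : ℕ) (ψ : Language.ring.Formula (Fin m ⊕ Fin n')) (z : Fin n' → K),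
      X' = {x | ψ.Realize (Sum.elim x z)})
    (hX'chart : ∀ x' ∈ X', (∀ j, MvPolynomial.eval (x' ∘ σ'.symm) (D' j) = 0) ∧
      ∀ j, MvPolynomial.eval (x' ∘ σ'.symm) (MvPolynomial.pderiv (Sum.inr j) (D' j)) ≠ 0)
    (hfin : ∀ x' : Fin m → K, {t : K | φ.Realize (Sum.elim (Fin.snoc x' t : Fin (m + 1) → K) y)}.Finite) :
    ∃ P : Polynomial (MvPolynomial (Fin e) K), P ≠ 0 ∧
      ∀ x : Fin (m + 1) → K, φ.Realize (Sum.elim x y) → Fin.init x ∈ X' →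
        (P.map (MvPolynomial.eval (fun i => x (Fin.castSucc (σ'.symm (Sum.inl i)))))).eval
          (x (Fin.last m)) = 0 := by
  classical
  haveI : Infinite K := Infinite.of_injective (Nat.cast : ℕ → K) Nat.cast_injective
  set A : Set (Fin (m + 1) → K) := {x | φ.Realize (Sum.elim x y)} with hA
  -- `A₁ = A ∩ {init ∈ X'}` is definable
  have hA₁def : ∃ (n' : ℕ) (ψ : Language.ring.Formula (Fin (m + 1) ⊕ Fin n')) (z : Fin n' → K),
      A ∩ {x | Fin.init x ∈ X'} = {x | ψ.Realize (Sum.elim x z)} := by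
    refine definableSet_inter ⟨n, φ, y, rfl⟩ ?_
    obtain ⟨n', ψ, z, h⟩ := definableSet_preimage_subst (K := K) (m := m) (m' := m + 1) (p := 0)
      (fun i => Sum.inl (Fin.castSucc i)) Fin.elim0 hX'def
    exact ⟨n', ψ, z, h⟩
  -- the `(t, u)`-projection
  obtain ⟨τ, hτlast, hτcast, hτ0, hτsucc, hτinr⟩ := exists_projSplit σ'
  obtain ⟨n₂, φ₂, y₂, hAt⟩ := definableSet_exists_block_equiv (K := K) τ (A ∩ {x | Fin.init x ∈ X'}) hA₁def
  -- reconstruction of a point from `(t, u)` and `w`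
  have hpoint : ∀ (v : Fin (e + 1) → K) (w : Fin k → K),
      (Fin.init (fun i => Sum.elim v w (τ i)) : Fin m → K) ∘ σ'.symm = Sum.elim (v ∘ Fin.succ) w := by
    intro v w
    funext s
    rcases s with u | j
    · simp only [Function.comp_apply, Fin.init, hτcast, Equiv.apply_symm_apply, Sum.map_inl,
        Sum.elim_inl]
    · simp only [Function.comp_apply, Fin.init, hτcast, Equiv.apply_symm_apply, Sum.map_inr, id_eq,
        Sum.elim_inr]
  have hlast : ∀ (v : Fin (e + 1) → K) (w : Fin k → K),
      (fun i => Sum.elim v w (τ i)) (Fin.last m) = v 0 := by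
    intro v w; simp only [hτlast, Sum.elim_inl]
  -- finiteness of the `t`-fibres of `A_t`
  have hfibre : ∀ v : Fin (e + 1) → K,
      {t : K | Function.update v 0 t ∈ {v' : Fin (e + 1) → K |
        ∃ w : Fin k → K, (fun i => Sum.elim v' w (τ i)) ∈ A ∩ {x | Fin.init x ∈ X'}}}.Finite := by
    intro v
    set W : Set (Fin k → K) := {w | (∀ j, MvPolynomial.eval (Sum.elim (v ∘ Fin.succ) w) (D' j) = 0) ∧
      ∀ j, MvPolynomial.eval (Sum.elim (v ∘ Fin.succ) w)
        (MvPolynomial.pderiv (Sum.inr j) (D' j)) ≠ 0} with hW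
    have hWfin : W.Finite := stub_finite_chart_fibre D' htri' (v ∘ Fin.succ)
    refine Set.Finite.subset (hWfin.biUnion fun w _ =>
      hfin (Fin.init (fun i => Sum.elim (Function.update v 0 (0 : K)) w (τ i)))) ?_
    intro t ht
    simp only [Set.mem_setOf_eq, Set.mem_inter_iff] at ht
    obtain ⟨w, hwA, hwX⟩ := ht
    simp only [Set.mem_iUnion, Set.mem_setOf_eq, exists_prop]
    refine ⟨w, ?_, ?_⟩
    · have := hX'chart _ hwX
      rw [hpoint] at this
      have hvs : (Function.update v 0 t) ∘ Fin.succ = v ∘ Fin.succ := by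
        funext u; simp [Fin.succ_ne_zero]
      rw [hvs] at this
      exact this
    · -- `snoc (init point) t = point`
      have hinit : Fin.init (fun i => Sum.elim (Function.update v 0 (0 : K)) w (τ i)) =
          Fin.init (fun i => Sum.elim (Function.update v 0 t) w (τ i)) := by
        funext i
        simp only [Fin.init, hτcast]
        rcases σ' i with u | j
        · simp [Fin.succ_ne_zero]
        · simp
      rw [hinit]
      have hsnoc : (Fin.snoc (Fin.init (fun i => Sum.elim (Function.update v 0 t) w (τ i))) t :
          Fin (m + 1) → K) = fun i => Sum.elim (Function.update v 0 t) w (τ i) := by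
        conv_rhs => rw [← Fin.snoc_init_self (fun i => Sum.elim (Function.update v 0 t) w (τ i))]
        congr 1
        simp [hτlast]
      rw [hsnoc]
      exact hwA
  -- the exceptional polynomial of `A_t`, which vanishes identically on `A_t`
  obtain ⟨Dt, hDt0, hint⟩ := stub_genericInterior h27 K hK φ₂ y₂
  have hvan : ∀ v : Fin (e + 1) → K, φ₂.Realize (Sum.elim v y₂) → MvPolynomial.eval v Dt = 0 := by
    intro v hv
    by_contra hne
    obtain ⟨r, E, hvE, hEsub⟩ := hint v hv hne
    have hinf := E.line_trace_infinite_psf K hK v hvE 0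
    apply hinf.not_finite
    refine (hfibre v).subset fun t ht => ?_
    have := hEsub ht
    rw [← hAt] at this
    exact this
  -- read `Dt` in `K[u][t]`
  refine ⟨MvPolynomial.finSuccEquiv K e Dt, (map_ne_zero_iff _ (MvPolynomial.finSuccEquiv K e).injective).2 hDt0, fun x hxA hxX => ?_⟩
  set v : Fin (e + 1) → K := Fin.cons (x (Fin.last m)) (fun i => x (Fin.castSucc (σ'.symm (Sum.inl i))))
    with hv
  have hxv : (fun i => Sum.elim v (fun j => x (Fin.castSucc (σ'.symm (Sum.inr j)))) (τ i)) = x := by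
    funext i
    cases i using Fin.lastCases with
    | last => simp [hτlast, hv]
    | cast i =>
      simp only [hτcast]
      rcases h : σ' i with u | j
      · simp only [Sum.map_inl, Sum.elim_inl, hv, Fin.cons_succ]
        rw [← h, Equiv.symm_apply_apply]
      · simp only [Sum.map_inr, id_eq, Sum.elim_inr]
        rw [← h, Equiv.symm_apply_apply]
  have hvAt : φ₂.Realize (Sum.elim v y₂) := by
    have : v ∈ {v' : Fin (e + 1) → K | ∃ w : Fin k → K,
        (fun i => Sum.elim v' w (τ i)) ∈ A ∩ {x | Fin.init x ∈ X'}} :=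
      ⟨fun j => x (Fin.castSucc (σ'.symm (Sum.inr j))), by rw [hxv]; exact ⟨hxA, hxX⟩⟩
    rw [hAt] at this
    exact this
  have h0 := hvan v hvAt
  rw [hv, MvPolynomial.eval_eq_eval_mv_eval'] at h0
  exact h0

end LiftRelation

end Summit.MatrixMultiplication.MatrixMultiplication.Theorems.PairwiseCurvedTilingsLC.Negative
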